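import Literature.Analysis.FluidPDE.ConstantinDirectionDissipationCalculus
import Literature.Analysis.FluidPDE.Ferrari1993PressureNeumannProblem
import Literature.Analysis.Calculus.HardyExteriorDecay
import Literature.Analysis.Calculus.HardyExteriorVanishingAtInfinity
import HarnessLib

/-!
# The whole-space div–curl identity `‖curl v‖_{L²(ℝ³)} = ‖∇v‖_{L²(ℝ³)}` for divergence-free
# fields vanishing at infinity

(namespace `Literature.Analysis.FluidPDE`.)

For a smooth divergence-free vector field `v` on `ℝ³` with finite Dirichlet energy
`D(v) = ∫ |∇v|² < ∞` and `v(x) → 0` as `|x| → ∞`,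

  `∫_{ℝ³} |curl v|² dx = ∫_{ℝ³} |∇v|² dx`

(`lintegral_norm_curl_sq_eq_lintegral_frobeniusNormSq`). This is the «standard whole-space
div–curl identity» invoked, e.g., as (3.3) of W. Wu, arXiv:2608.22471 (claim C177 of the D-0090
sweep, `Literature.Claims.NS.Wu2026.Step_33`), and classically in Galdi 2011 (proof of
Thm. X.9.5 / Lemma II.6.x: fields with `∇v ∈ L²` vanishing at infinity).

Proof, entirely in physical space (no Fourier transform):
* pointwise algebra (`frobeniusNormSq_sub_norm_curlCLM_sq`): for every `L : ℝ³ →L ℝ³`,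
  `|L|²_F − |curl L|² = tr (L ∘ L)`;
* for a smooth divergence-free field, `tr (Dv ∘ Dv) = div ((v·∇)v)` (the tree's
  `divergence_convect_self_eq_trace`, Ferrari 1993 (10)), hence
  `|∇v|² − |curl v|² = div ((v·∇)v)` pointwise (`frobeniusNormSq_sub_norm_curl_sq_eq_divergence`);
* test against the tree's radial cut-offs `χ_k` (`Literature.Analysis.Calculus.exists_scaled_cutoff`:
  `χ_k = 1` on `B_k`, `= 0` off `B_{2k}`, `‖Dχ_k(y)‖ ≤ 2C₁/‖y‖`) and integrate by parts without
  boundary terms (`integral_mul_divergence_add_eq_zero_left`):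
  `∫ χ_k (|∇v|² − |curl v|²) = −∫ Dχ_k[(v·∇)v]`;
* the right side is `O(∫_{‖y‖ ≥ k} (‖v‖²/‖y‖² + |∇v|²))`, which tends to `0` by Hardy's inequality for
  fields vanishing at infinity (`hardy_sq_lintegral_exterior_le_of_tendsto_cocompact`, applied to
  the components of `v`) and `D(v) < ∞`; the left side tends to `∫ (|∇v|² − |curl v|²)` by dominated
  convergence (`|curl v|² ≤ 2|∇v|²`, `norm_curl_sq_le_two_mul_frobeniusNormSq`).

## Mathlib / tree search

Mathlib has no curl. The tree has the pointwise bound `norm_curl_sq_le_two_mul_frobeniusNormSq`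
and the vortex-stretching algebra of `ConstantinDirectionDissipationCalculus.lean` (reused:
`curlCLM_apply_coord`, `frobeniusNormSq_eq_sum_sq_coord`), whole-space IBP and cut-offs
(`WholeSpaceIBP.lean`, `HardyExteriorDecay.lean`), but no `L²` div–curl identity on `ℝ³`
(searched `div.?curl`, `norm_curl_sq_eq`, `curl.*frobeniusNormSq.*integral`).

## References

* G. P. Galdi, *An Introduction to the Mathematical Theory of the Navier–Stokes Equations.
  Steady-State Problems*, 2nd ed., Springer (2011), §II.6 (Thm. II.6.1) and the identity
  `‖∇v‖₂ = ‖curl v‖₂ + ‖div v‖₂`-type computations of §III.1. Key `Galdi2011`.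
* W. Wu, arXiv:2608.22471v1 (2026), (3.3) p. 7 («the standard whole-space div–curl identity»).
  Key `Wu2026`.
-/


noncomputable section

open MeasureTheory Set Filter Topology Module
open scoped RealInnerProductSpace ENNReal NNReal Topology

namespace Literature.Analysis.FluidPDE

/-! ### Pointwise algebra: `|L|²_F − |curl L|² = tr (L ∘ L)` -/

/-- The trace of `L ∘ L` in coordinates: `tr (L ∘ L) = Σᵢⱼ (L eᵢ)ⱼ (L eⱼ)ᵢ`. [folklore] -/
private theorem trace_comp_self_eq_sum_basisFun (L : (EuclideanSpace ℝ (Fin 3)) →L[ℝ] (EuclideanSpace ℝ (Fin 3))) :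
    LinearMap.trace ℝ (EuclideanSpace ℝ (Fin 3)) ((L.comp L : (EuclideanSpace ℝ (Fin 3)) →L[ℝ] (EuclideanSpace ℝ (Fin 3))) : (EuclideanSpace ℝ (Fin 3)) →ₗ[ℝ] (EuclideanSpace ℝ (Fin 3))) =
      ∑ i, ∑ j, L ((EuclideanSpace.basisFun (Fin 3) ℝ) i) j *
        L ((EuclideanSpace.basisFun (Fin 3) ℝ) j) i := by
  set b := EuclideanSpace.basisFun (Fin 3) ℝ with hb
  rw [LinearMap.trace_eq_sum_inner _ b]
  refine Finset.sum_congr rfl fun i _ => ?_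
  have hexp : L (b i) = ∑ j, (L (b i)) j • (b j : (EuclideanSpace ℝ (Fin 3))) := by
    conv_lhs => rw [← b.sum_repr' (L (b i))]
    refine Finset.sum_congr rfl fun j _ => ?_
    rw [EuclideanSpace.basisFun_inner]
  rw [ContinuousLinearMap.coe_coe, ContinuousLinearMap.comp_apply]
  conv_lhs => rw [hexp, map_sum]
  rw [EuclideanSpace.basisFun_inner]
  simp [map_smul]

/-- **`|L|²_F − |curl L|² = tr (L ∘ L)`** for every linear map `L : ℝ³ → ℝ³` (with `curl L` the curl
vector `curlCLM L` of the Jacobian `L`): in coordinates, `Σᵢⱼ Lᵢⱼ² − Σ_{i<j} (Lᵢⱼ − Lⱼᵢ)² =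
Σᵢⱼ Lᵢⱼ Lⱼᵢ` — the algebra of the decomposition `L = 𝒟 + Ω`, `Ωh = ½ ω × h` (Majda–Bertozzi 2002,
§1.2, (1.19)–(1.24): `|L|²_F = |𝒟|² + |Ω|²`, `|ω|² = 2|Ω|²`, `tr (L ∘ L) = |𝒟|² − |Ω|²`).
[cite: MajdaBertozziCUP2002, §1.2 eqs. (1.19)–(1.24)] -/
theorem frobeniusNormSq_sub_norm_curlCLM_sq (L : (EuclideanSpace ℝ (Fin 3)) →L[ℝ] (EuclideanSpace ℝ (Fin 3))) :
    frobeniusNormSq L - ‖curlCLM L‖ ^ 2 =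
      LinearMap.trace ℝ (EuclideanSpace ℝ (Fin 3)) ((L.comp L : (EuclideanSpace ℝ (Fin 3)) →L[ℝ] (EuclideanSpace ℝ (Fin 3))) : (EuclideanSpace ℝ (Fin 3)) →ₗ[ℝ] (EuclideanSpace ℝ (Fin 3))) := by
  have hnorm : ‖curlCLM L‖ ^ 2 = ∑ i, (curlCLM L) i ^ 2 := by
    rw [EuclideanSpace.norm_sq_eq]
    simp [Real.norm_eq_abs, sq_abs]
  obtain ⟨h0, h1, h2⟩ := curlCLM_apply_coord L
  rw [hnorm, frobeniusNormSq_eq_sum_sq_coord, trace_comp_self_eq_sum_basisFun]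
  simp only [Fin.sum_univ_three, h0, h1, h2]
  ring


/-! ### The pointwise identity for smooth divergence-free fields -/

/-- **`|∇v|² − |curl v|² = div ((v·∇)v)`** pointwise, for a smooth divergence-free field `v` on
`ℝ³`: the Majda–Bertozzi algebra `|∇v|² − |ω|² = tr (Dv ∘ Dv)` (§1.2, (1.19)–(1.24)) combined with
`tr (Dv ∘ Dv) = Σᵢⱼ ∂ᵢvⱼ ∂ⱼvᵢ = div ((v·∇)v)` for `div v = 0` (the tree's
`divergence_convect_self_eq_trace`, Ferrari 1993 (10)). [cite: MajdaBertozziCUP2002, §1.2 eqs. (1.19)–(1.24)] -/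
theorem frobeniusNormSq_sub_norm_curl_sq_eq_divergence {v : (EuclideanSpace ℝ (Fin 3)) → (EuclideanSpace ℝ (Fin 3))}
    (hv : ContDiff ℝ (⊤ : ℕ∞) v) (hdiv : VectorCalculus.IsDivFree v) (x : (EuclideanSpace ℝ (Fin 3))) :
    frobeniusNormSq (fderiv ℝ v x) - ‖curl v x‖ ^ 2 =
      VectorCalculus.divergence (convect v v) x := by
  rw [curl_eq_curlCLM, frobeniusNormSq_sub_norm_curlCLM_sq,
    divergence_convect_self_eq_trace isOpen_univ hv.contDiffOn (fun y _ => hdiv y) (mem_univ x)]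

/-! ### Hardy's inequality for vector fields vanishing at infinity (crude constant) -/

/-- Each component of a `C¹` field is `C¹`, with `‖D(vᵢ)(y)‖² ≤ |Dv(y)|²_F`. [folklore] -/
private theorem norm_fderiv_apply_coord_sq_le {v : (EuclideanSpace ℝ (Fin 3)) → (EuclideanSpace ℝ (Fin 3))} (hv : ContDiff ℝ 1 v) (i : Fin 3) (y : (EuclideanSpace ℝ (Fin 3))) :
    ‖fderiv ℝ (fun z => v z i) y‖ ^ 2 ≤ frobeniusNormSq (fderiv ℝ v y) := by
  have hd : HasFDerivAt (fun z => v z i) ((EuclideanSpace.proj i).comp (fderiv ℝ v y)) y :=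
    (EuclideanSpace.proj (𝕜 := ℝ) i).hasFDerivAt.comp y
      ((hv.differentiable one_ne_zero) y).hasFDerivAt
  rw [hd.fderiv]
  have h1 : ‖(EuclideanSpace.proj (𝕜 := ℝ) i).comp (fderiv ℝ v y)‖ ≤ ‖fderiv ℝ v y‖ := by
    refine ContinuousLinearMap.opNorm_le_bound _ (norm_nonneg _) fun h => ?_
    calc ‖((EuclideanSpace.proj (𝕜 := ℝ) i).comp (fderiv ℝ v y)) h‖ = ‖(fderiv ℝ v y h) i‖ := rfl
      _ ≤ ‖fderiv ℝ v y h‖ := PiLp.norm_apply_le _ i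
      _ ≤ ‖fderiv ℝ v y‖ * ‖h‖ := (fderiv ℝ v y).le_opNorm h
  calc ‖(EuclideanSpace.proj (𝕜 := ℝ) i).comp (fderiv ℝ v y)‖ ^ 2 ≤ ‖fderiv ℝ v y‖ ^ 2 := by
        gcongr
    _ ≤ frobeniusNormSq (fderiv ℝ v y) := sq_opNorm_le_frobeniusNormSq _

/-- **Hardy's inequality for a `C¹` vector field vanishing at infinity** (components of
`Literature.Analysis.Calculus.hardy_sq_lintegral_exterior_le_of_tendsto_cocompact`, with a crude
constant): `∫_{‖y‖>R} ‖v‖²/‖y‖² ≤ 12 ∫_{‖y‖>R} |∇v|²` in `[0, ∞]`. [cite: Galdi2011, §II.6, Thm. II.6.1 (Hardy-type inequality for fields with ∇v ∈ L² vanishing at infinity)] -/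
theorem lintegral_exterior_norm_sq_div_norm_sq_le {v : (EuclideanSpace ℝ (Fin 3)) → (EuclideanSpace ℝ (Fin 3))} (hv : ContDiff ℝ 1 v)
    (h0 : Tendsto v (cocompact (EuclideanSpace ℝ (Fin 3))) (𝓝 0)) {R : ℝ} (hR : 0 < R) :
    ∫⁻ y in {y : (EuclideanSpace ℝ (Fin 3)) | R < ‖y‖}, ENNReal.ofReal (‖v y‖ ^ 2 / ‖y‖ ^ 2) ≤
      12 * ∫⁻ y in {y : (EuclideanSpace ℝ (Fin 3)) | R < ‖y‖}, ENNReal.ofReal (frobeniusNormSq (fderiv ℝ v y)) := by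
  set S : Set (EuclideanSpace ℝ (Fin 3)) := {y | R < ‖y‖} with hS
  have hn : 3 ≤ finrank ℝ (EuclideanSpace ℝ (Fin 3)) := by rw [finrank_euclideanSpace_fin]
  -- componentwise Hardy
  have hcomp : ∀ i : Fin 3, ∫⁻ y in S, ENNReal.ofReal ((v y i) ^ 2 / ‖y‖ ^ 2) ≤
      4 * ∫⁻ y in S, ENNReal.ofReal (frobeniusNormSq (fderiv ℝ v y)) := by
    intro i
    have hvi : ContDiff ℝ 1 fun z => v z i := contDiff_euclidean.1 hv i
    have h0i : Tendsto (fun z => v z i) (cocompact (EuclideanSpace ℝ (Fin 3))) (𝓝 0) := by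
      have h := ((EuclideanSpace.proj (𝕜 := ℝ) i).continuous.tendsto 0).comp h0
      rw [map_zero] at h
      exact h
    have hH := Literature.Analysis.Calculus.hardy_sq_lintegral_exterior_le_of_tendsto_cocompact
      hvi h0i hR hn
    have hconst : ENNReal.ofReal ((2 / ((finrank ℝ (EuclideanSpace ℝ (Fin 3)) : ℝ) - 2)) ^ 2) = 4 := by
      rw [finrank_euclideanSpace_fin]
      norm_num
    rw [hconst] at hH
    refine hH.trans ?_
    gcongr with y
    exact norm_fderiv_apply_coord_sq_le hv i y
  -- sum over the three components
  have hsplit : ∀ y : (EuclideanSpace ℝ (Fin 3)), ENNReal.ofReal (‖v y‖ ^ 2 / ‖y‖ ^ 2) =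
      ∑ i, ENNReal.ofReal ((v y i) ^ 2 / ‖y‖ ^ 2) := by
    intro y
    rw [EuclideanSpace.real_norm_sq_eq, Finset.sum_div,
      ENNReal.ofReal_sum_of_nonneg fun i _ => div_nonneg (sq_nonneg _) (sq_nonneg _)]
  calc ∫⁻ y in S, ENNReal.ofReal (‖v y‖ ^ 2 / ‖y‖ ^ 2)
      = ∫⁻ y in S, ∑ i, ENNReal.ofReal ((v y i) ^ 2 / ‖y‖ ^ 2) := lintegral_congr fun y => hsplit y
    _ = ∑ i : Fin 3, ∫⁻ y in S, ENNReal.ofReal ((v y i) ^ 2 / ‖y‖ ^ 2) := by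
        refine lintegral_finsetSum _ fun i _ => ?_
        exact (((contDiff_euclidean.1 hv i).continuous.measurable.pow_const 2).div
          (continuous_norm.measurable.pow_const 2)).ennreal_ofReal
    _ ≤ ∑ _i : Fin 3, 4 * ∫⁻ y in S, ENNReal.ofReal (frobeniusNormSq (fderiv ℝ v y)) :=
        Finset.sum_le_sum fun i _ => hcomp i
    _ = 12 * ∫⁻ y in S, ENNReal.ofReal (frobeniusNormSq (fderiv ℝ v y)) := by
        simp only [Finset.sum_const, Finset.card_univ, Fintype.card_fin, nsmul_eq_mul]
        norm_num
        ring


/-! ### The div–curl identity -/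

/-- **The whole-space div–curl identity** (the «standard whole-space div–curl identity», Wu 2026
(3.3); Galdi 2011, §II.6): for a smooth divergence-free field `v : ℝ³ → ℝ³` tending to `0` at
infinity with finite Dirichlet energy `∫ |∇v|² < ∞`,

  `∫_{ℝ³} |curl v|² = ∫_{ℝ³} |∇v|²` (in `[0, ∞]`).

Proof: integrate the pointwise identity `|∇v|² − |curl v|² = div ((v·∇)v)`
(`frobeniusNormSq_sub_norm_curl_sq_eq_divergence`) against the radial cut-offs `χ_k` of
`Literature.Analysis.Calculus.exists_scaled_cutoff` (no boundary terms,
`integral_mul_divergence_add_eq_zero_left`); the error `∫ Dχ_k[(v·∇)v]` is bounded by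
`C₁ ∫_{‖y‖ ≥ k} (‖v‖²/‖y‖² + |∇v|²) → 0` thanks to Hardy's inequality for fields vanishing at
infinity (`lintegral_exterior_norm_sq_div_norm_sq_le`), and `∫ χ_k (|∇v|² − |curl v|²) →
∫ (|∇v|² − |curl v|²)` by dominated convergence. [cite: Wu2026, (3.3) p.7 l.20–26 («the standard whole-space div–curl identity [8]», [8] = Galdi 2011)] [cite: Galdi2011, §II.6 (fields with ∇v ∈ L² vanishing at infinity)] -/
theorem lintegral_norm_curl_sq_eq_lintegral_frobeniusNormSq {v : (EuclideanSpace ℝ (Fin 3)) → (EuclideanSpace ℝ (Fin 3))}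
    (hv : ContDiff ℝ (⊤ : ℕ∞) v) (hdiv : VectorCalculus.IsDivFree v)
    (h0 : Tendsto v (cocompact (EuclideanSpace ℝ (Fin 3))) (𝓝 0))
    (hD : ∫⁻ x, ENNReal.ofReal (frobeniusNormSq (fderiv ℝ v x)) < ∞) :
    ∫⁻ x, ENNReal.ofReal (‖curl v x‖ ^ 2) =
      ∫⁻ x, ENNReal.ofReal (frobeniusNormSq (fderiv ℝ v x)) := by
  -- the two densities and the convective field
  set F : (EuclideanSpace ℝ (Fin 3)) → ℝ := fun x => frobeniusNormSq (fderiv ℝ v x) with hF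
  set Cu : (EuclideanSpace ℝ (Fin 3)) → ℝ := fun x => ‖curl v x‖ ^ 2 with hCu
  set W : (EuclideanSpace ℝ (Fin 3)) → (EuclideanSpace ℝ (Fin 3)) := convect v v with hW
  have hv1 : ContDiff ℝ 1 v := hv.of_le (by simp)
  have hv2 : ContDiff ℝ 2 v := hv.of_le (by norm_cast)
  have hFc : Continuous F := continuous_frobeniusNormSq_fderiv hv1 one_ne_zero
  have hFnn : ∀ x, 0 ≤ F x := fun x => frobeniusNormSq_nonneg _
  have hCuc : Continuous Cu := by
    have : Continuous (curl v) := by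
      rw [curl_eq_curlCLM_comp]
      exact curlCLM.continuous.comp (hv1.continuous_fderiv one_ne_zero)
    exact (continuous_norm.comp this).pow 2
  have hCunn : ∀ x, 0 ≤ Cu x := fun x => sq_nonneg _
  have hCuF : ∀ x, Cu x ≤ 2 * F x := fun x => norm_curl_sq_le_two_mul_frobeniusNormSq v x
  -- integrability of `F` and `Cu`
  have hFi : Integrable F := by
    refine ⟨hFc.aestronglyMeasurable, ?_⟩
    rw [hasFiniteIntegral_iff_ofReal (ae_of_all _ hFnn)]
    exact hD
  have hCui : Integrable Cu := by
    refine (hFi.const_mul 2).mono' hCuc.aestronglyMeasurable (ae_of_all _ fun x => ?_)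
    rw [Real.norm_eq_abs, abs_of_nonneg (hCunn x)]
    exact hCuF x
  -- the convective field is `C¹`
  have hW1 : ContDiff ℝ 1 W := by
    have hDv : ContDiff ℝ 1 (fderiv ℝ v) := hv2.fderiv_right (by norm_num)
    exact hDv.clm_apply hv1
  -- the pointwise identity
  have hpt : ∀ x, F x - Cu x = VectorCalculus.divergence W x := fun x =>
    frobeniusNormSq_sub_norm_curl_sq_eq_divergence hv hdiv x
  -- Hardy: `H = ‖v‖²/‖y‖²` is integrable on `S = {1/2 < ‖y‖}`
  set S : Set (EuclideanSpace ℝ (Fin 3)) := {y | (1 / 2 : ℝ) < ‖y‖} with hS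
  have hSm : MeasurableSet S := (isOpen_lt continuous_const continuous_norm).measurableSet
  set H : (EuclideanSpace ℝ (Fin 3)) → ℝ := fun y => ‖v y‖ ^ 2 / ‖y‖ ^ 2 with hH
  have hHnn : ∀ y, 0 ≤ H y := fun y => div_nonneg (sq_nonneg _) (sq_nonneg _)
  have hHi : IntegrableOn H S := by
    refine ⟨(((continuous_norm.comp hv.continuous).measurable.pow_const 2).div
      (continuous_norm.measurable.pow_const 2)).aestronglyMeasurable, ?_⟩
    rw [hasFiniteIntegral_iff_ofReal (ae_of_all _ hHnn)]
    have h1 := lintegral_exterior_norm_sq_div_norm_sq_le hv1 h0 (by norm_num : (0 : ℝ) < 1 / 2)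
    refine h1.trans_lt (ENNReal.mul_lt_top (by norm_num) ?_)
    exact (setLIntegral_le_lintegral S _).trans_lt hD
  -- the cut-offs
  obtain ⟨χ, C₁, hC₁, hχ⟩ := Literature.Analysis.Calculus.exists_scaled_cutoff (E := (EuclideanSpace ℝ (Fin 3)))
  have hkpos : ∀ n : ℕ, (0 : ℝ) < (n : ℝ) + 1 := fun n => by positivity
  have hχC : ∀ n : ℕ, ContDiff ℝ 1 (χ ((n : ℝ) + 1)) := fun n => (hχ _ (hkpos n)).1
  have hχnn : ∀ (n : ℕ) y, 0 ≤ χ ((n : ℝ) + 1) y := fun n => (hχ _ (hkpos n)).2.1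
  have hχle : ∀ (n : ℕ) y, χ ((n : ℝ) + 1) y ≤ 1 := fun n => (hχ _ (hkpos n)).2.2.1
  have hχone : ∀ (n : ℕ) (y : (EuclideanSpace ℝ (Fin 3))), ‖y‖ ≤ (n : ℝ) + 1 → χ ((n : ℝ) + 1) y = 1 :=
    fun n => (hχ _ (hkpos n)).2.2.2.1
  have hχzero : ∀ (n : ℕ) (y : (EuclideanSpace ℝ (Fin 3))), 2 * ((n : ℝ) + 1) ≤ ‖y‖ → χ ((n : ℝ) + 1) y = 0 :=
    fun n => (hχ _ (hkpos n)).2.2.2.2.1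
  have hDχ0 : ∀ (n : ℕ) (y : (EuclideanSpace ℝ (Fin 3))), ‖y‖ < (n : ℝ) + 1 → fderiv ℝ (χ ((n : ℝ) + 1)) y = 0 :=
    fun n => (hχ _ (hkpos n)).2.2.2.2.2.1
  have hDχ : ∀ (n : ℕ) (y : (EuclideanSpace ℝ (Fin 3))), (n : ℝ) + 1 ≤ ‖y‖ →
      ‖fderiv ℝ (χ ((n : ℝ) + 1)) y‖ ≤ 2 * C₁ / ‖y‖ := fun n => (hχ _ (hkpos n)).2.2.2.2.2.2
  have hχsupp : ∀ n : ℕ, HasCompactSupport (χ ((n : ℝ) + 1)) := fun n =>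
    HasCompactSupport.intro (isCompact_closedBall (0 : (EuclideanSpace ℝ (Fin 3))) (2 * ((n : ℝ) + 1))) fun y hy => by
      rw [mem_closedBall_zero_iff, not_le] at hy
      exact hχzero n y hy.le
  have hgrad_norm : ∀ (n : ℕ) (y : (EuclideanSpace ℝ (Fin 3))), ‖gradient (χ ((n : ℝ) + 1)) y‖ =
      ‖fderiv ℝ (χ ((n : ℝ) + 1)) y‖ := fun n y => by
    rw [gradient]
    exact (InnerProductSpace.toDual ℝ (EuclideanSpace ℝ (Fin 3))).symm.norm_map _
  -- integration by parts against each cut-off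
  set A : ℕ → ℝ := fun n => ∫ y, χ ((n : ℝ) + 1) y * (F y - Cu y) with hA
  set B : ℕ → ℝ := fun n => ∫ y, ⟪W y, gradient (χ ((n : ℝ) + 1)) y⟫ with hB
  have hAB : ∀ n, A n + B n = 0 := by
    intro n
    have h := integral_mul_divergence_add_eq_zero_left (hχC n) hW1 (hχsupp n)
    have hA' : A n = ∫ y, χ ((n : ℝ) + 1) y * VectorCalculus.divergence W y := by
      simp only [hA, hpt]
    rw [hA']
    exact h
  -- `A n → ∫ (F − Cu)` by dominated convergence
  have hAlim : Tendsto A atTop (𝓝 (∫ y, (F y - Cu y))) := by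
    refine tendsto_integral_of_dominated_convergence (fun y => F y + Cu y) (fun n => ?_)
      (hFi.add hCui) (fun n => ae_of_all _ fun y => ?_) (ae_of_all _ fun y => ?_)
    · exact ((hχC n).continuous.mul (hFc.sub hCuc)).aestronglyMeasurable
    · rw [Real.norm_eq_abs, abs_mul, abs_of_nonneg (hχnn n y)]
      have h1 : |F y - Cu y| ≤ F y + Cu y :=
        abs_sub_le_iff.2 ⟨by linarith [hCunn y], by linarith [hFnn y]⟩
      calc χ ((n : ℝ) + 1) y * |F y - Cu y| ≤ 1 * (F y + Cu y) :=
            mul_le_mul (hχle n y) h1 (abs_nonneg _) zero_le_one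
        _ = F y + Cu y := one_mul _
    · obtain ⟨N, hN⟩ := exists_nat_ge ‖y‖
      refine tendsto_atTop_of_eventually_const (i₀ := N) fun n hn => ?_
      have hyn : ‖y‖ ≤ (n : ℝ) + 1 := by
        have : (N : ℝ) ≤ n := by exact_mod_cast hn
        linarith
      rw [hχone n y hyn, one_mul]
  -- `B n → 0` by dominated convergence (Hardy bound)
  have hBlim : Tendsto B atTop (𝓝 0) := by
    have hGi : Integrable fun y => C₁ * (S.indicator H y + F y) :=
      ((hHi.integrable_indicator hSm).add hFi).const_mul C₁
    have h := tendsto_integral_of_dominated_convergence (fun y => C₁ * (S.indicator H y + F y))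
      (F := fun (n : ℕ) y => ⟪W y, gradient (χ ((n : ℝ) + 1)) y⟫) (f := fun _ => (0 : ℝ))
      (fun n => ?_) hGi (fun n => ae_of_all _ fun y => ?_) (ae_of_all _ fun y => ?_)
    · simp only [integral_zero] at h
      exact h
    · exact (hW1.continuous.inner (continuous_gradient_of_contDiff (hχC n))).aestronglyMeasurable
    · -- the pointwise bound `|⟪W, ∇χ_k⟫| ≤ C₁ (1_S H + F)`
      have hGnn : 0 ≤ C₁ * (S.indicator H y + F y) :=
        mul_nonneg hC₁ (add_nonneg (Set.indicator_nonneg (fun z _ => hHnn z) y) (hFnn y))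
      have hin : ‖⟪W y, gradient (χ ((n : ℝ) + 1)) y⟫‖ ≤
          ‖W y‖ * ‖fderiv ℝ (χ ((n : ℝ) + 1)) y‖ := by
        rw [← hgrad_norm n y]
        exact norm_inner_le_norm _ _
      by_cases hyk : ‖y‖ < (n : ℝ) + 1
      · rw [hDχ0 n y hyk, norm_zero, mul_zero] at hin
        exact hin.trans hGnn
      · push Not at hyk
        have hypos : 0 < ‖y‖ := (hkpos n).trans_le hyk
        have hyS : y ∈ S := by
          show (1 / 2 : ℝ) < ‖y‖
          have : (1 : ℝ) ≤ (n : ℝ) + 1 := by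
            have : (0 : ℝ) ≤ n := Nat.cast_nonneg n
            linarith
          linarith
        have hWn : ‖W y‖ ≤ ‖fderiv ℝ v y‖ * ‖v y‖ := (fderiv ℝ v y).le_opNorm (v y)
        have hDv2 : ‖fderiv ℝ v y‖ ^ 2 ≤ F y := sq_opNorm_le_frobeniusNormSq _
        have hHy : S.indicator H y = (‖v y‖ / ‖y‖) ^ 2 := by
          rw [indicator_of_mem hyS, hH, div_pow]
        calc ‖⟪W y, gradient (χ ((n : ℝ) + 1)) y⟫‖
            ≤ ‖W y‖ * ‖fderiv ℝ (χ ((n : ℝ) + 1)) y‖ := hin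
          _ ≤ (‖fderiv ℝ v y‖ * ‖v y‖) * (2 * C₁ / ‖y‖) := by
              gcongr
              exact hDχ n y hyk
          _ = C₁ * (2 * (‖v y‖ / ‖y‖) * ‖fderiv ℝ v y‖) := by
              rw [div_eq_mul_inv, div_eq_mul_inv]
              ring
          _ ≤ C₁ * ((‖v y‖ / ‖y‖) ^ 2 + ‖fderiv ℝ v y‖ ^ 2) := by
              gcongr
              exact two_mul_le_add_sq _ _
          _ ≤ C₁ * (S.indicator H y + F y) := by
              rw [hHy]
              gcongr
    · -- pointwise limit `0`: the gradient of `χ_k` vanishes at `y` for `k > ‖y‖`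
      obtain ⟨N, hN⟩ := exists_nat_ge ‖y‖
      refine tendsto_atTop_of_eventually_const (i₀ := N) fun n hn => ?_
      have hyn : ‖y‖ < (n : ℝ) + 1 := by
        have : (N : ℝ) ≤ n := by exact_mod_cast hn
        linarith
      have : gradient (χ ((n : ℝ) + 1)) y = 0 := by
        rw [gradient, hDχ0 n y hyn, map_zero]
      rw [this, inner_zero_right]
  -- conclusion: `∫ (F − Cu) = 0`
  have hA0 : Tendsto A atTop (𝓝 0) := by
    have h := hBlim.neg
    rw [neg_zero] at h
    exact h.congr fun n => by linarith [hAB n]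
  have hI : ∫ y, (F y - Cu y) = 0 := tendsto_nhds_unique hAlim hA0
  rw [integral_sub hFi hCui, sub_eq_zero] at hI
  rw [← ofReal_integral_eq_lintegral_ofReal hCui (ae_of_all _ hCunn),
    ← ofReal_integral_eq_lintegral_ofReal hFi (ae_of_all _ hFnn), hI]

end Literature.Analysis.FluidPDE
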